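import Mathlib
import Summits.ValiantsHypothesis.ValiantsHypothesis.Theorems.GrenetZeonPolySizeQPAlgebraBlockNormalFormGeneral
import Summits.ValiantsHypothesis.ValiantsHypothesis.Theorems.GrenetZeonPolySizeQPAlgebraResidualCorankTwoBlock
import Summits.ValiantsHypothesis.ValiantsHypothesis.Theorems.GrenetZeonPolySizeQPAlgebraAdjugateLengthDiagonal
import HarnessLib

/-!
# Crux `GrenetZeon.PolySizeQPAlgebra` (stmt-ValiantsHypothesis-8064), line `vbp-slice-dealg` —
# the Hessian rank at a block normal form `diag(1_κ, S)` of ANY residual corank: `rank ≤ G + |κ|·AL`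

`…ResidualCorankTwoBlock` bounds the Hessian of `λ(det A)` at a point with value matrix `diag(1_κ, S)`,
`S ∈ Mat₂`, `det S = 0`, by splitting the closed form into a symmetrised `2 × 2` form (the "graph lemma",
`4·dim R`) and `|κ|` pairs of bilinear read-outs through `adj S`, `(adj S)ᵀ` (lengths of the column / row
modules of `adj S`, inequality `AL(2)`).  With the closed form for residual blocks of any size
(`eval_pderiv_pderiv_det_blockNormalForm_general`, `…BlockNormalFormGeneral`) the same splitting holds for
every `q`; this file records it BY NAME, with the two counts of the hand memos as explicit inputs:

* `rank_hess0_transl_le_of_blockNormalForm_general` — **at `A(p) = diag(1_κ, S)`, `S ∈ Mat_q(R)`,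
  `det S = 0`: `rank Hess λ(det A)(p) ≤ rank G + |κ| · (ℓ Col(adj S) + ℓ Row(adj S))`**, where `G` is the
  symmetrised `q × q` form `(s,t) ↦ λ(tr X₁₁·tr(adj S·Y₂₂) + tr Y₁₁·tr(adj S·X₂₂) + Σ_{r≠r'} det(S | row r ←
  (Y₂₂)_r, row r' ← (X₂₂)_{r'}))` (memo: `T₁ + T₂ + T₃ + T₄`) and the read-outs are the second polarisation
  `T₅`.  So the type-independent bound `2·dim R·(|κ| + q)` at such a point follows from
  `AL(q)`: `ℓ Col(adj S) + ℓ Row(adj S) ≤ 2 dim R` and `G(q)`: `rank G ≤ 2q·dim R`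
  (`rank_hess0_transl_le_of_blockNormalForm_general_of_AL`).
* `rank_hess0_transl_le_of_blockNormalForm_diagonal` — for a DIAGONAL residual block `AL(q)` is a theorem
  (`finrank_range_adjugate_diagonal_le`, `…AdjugateLengthDiagonal`): `rank ≤ rank G + 2|κ|·dim R`.

Exact computations (hand folder `calc/hessform.py`: `R = ℂ[ε]/ε⁴, ℂ[ε]/ε⁵`, the `(1,2,1,1)` type
`ℂ[x,y]/(xy, y²-x³)`, `q = 3`, `κ = 2`) find both counts attained with equality at points of minimal
vanishing (`rank = 2·dim R·n` there), so the split is sharp.  HONEST FRAMING: bookkeeping of a conditional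
count; `AL(q)` (`q ≥ 3`, non-diagonal blocks) and `G(q)` remain inputs; no stub of the line is closed;
VP ≠ VNP is not moved.

References: T. Mignon, N. Ressayre, IMRN 2004:79, §2 [MignonRessayre2004].
-/

noncomputable section

open MvPolynomial Matrix
open Literature.Computability.AlgebraicComplexity

-- single-conjunct layout `Summits/ValiantsHypothesis/ValiantsHypothesis`: duplicated namespace by design
set_option linter.dupNamespace false

namespace Summit.ValiantsHypothesis.ValiantsHypothesis.Theorems.GrenetZeonPolySizeQPAlgebra

section RankGeneral

variable {R : Type*} [CommRing R] [Algebra ℂ R] [Module.Finite ℂ R]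
variable {σ : Type*} [Fintype σ] [DecidableEq σ] {κ : Type*} [Fintype κ] [DecidableEq κ]

omit [Algebra ℂ R] [Module.Finite ℂ R] [Fintype σ] [DecidableEq σ] [DecidableEq κ] in
/-- The second polarisation `tr(adj S · (-(X₂₁Y₁₂ + Y₂₁X₁₂)))` as `|κ|` pairs of bilinear read-outs through
`(adj S)ᵀ` and `adj S`. [folklore] -/
theorem trace_adjugate_mul_neg_eq_sums {q : ℕ} (S : Matrix (Fin q) (Fin q) R)
    (X Y : Matrix (κ ⊕ Fin q) (κ ⊕ Fin q) R) :
    (S.adjugate * -(X.toBlocks₂₁ * Y.toBlocks₁₂ + Y.toBlocks₂₁ * X.toBlocks₁₂)).trace =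
      -((∑ c, (fun b => X.toBlocks₂₁ b c) ⬝ᵥ (S.adjugateᵀ *ᵥ fun a => Y.toBlocks₁₂ c a)) +
        ∑ c, (fun a => X.toBlocks₁₂ c a) ⬝ᵥ (S.adjugate *ᵥ fun b => Y.toBlocks₂₁ b c)) := by
  rw [Matrix.mul_neg, Matrix.trace_neg, Matrix.mul_add, Matrix.trace_add,
    trace_mul_mul_eq_sum_dotProduct, trace_mul_mul_eq_sum_dotProduct]
  congr 1; congr 1
  exact Finset.sum_congr rfl fun c _ => dotProduct_mulVec_eq_dotProduct_transpose_mulVec _ _ _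

/-- **Hessian rank at a block normal form of any residual corank: `rank ≤ rank G + |κ|·(ℓ Col + ℓ Row)`.**
Let `R` be a finite-dimensional commutative `ℂ`-algebra, `λ : R → ℂ` linear, `A` a square matrix of affine
forms over `R[x_σ]` indexed by `κ ⊕ Fin q` with `A(p) = diag(1_κ, S)`, `det S = 0`, `F = λ(det A)`
coefficientwise, and `X_s = ∂_s A(p)`.  If the symmetrised `q × q` form
`G = ((s,t) ↦ λ(tr (X_s)₁₁ · tr(adj S·(X_t)₂₂) + tr (X_t)₁₁ · tr(adj S·(X_s)₂₂)
  + Σ_r Σ_{r'≠r} det(S | row r ← ((X_t)₂₂)_r, row r' ← ((X_s)₂₂)_{r'})))` has rank `≤ g`, then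
`rank Hess F(p) ≤ g + |κ| · (dim_ℂ Col(adj S) + dim_ℂ Row(adj S))`
(`eval_pderiv_pderiv_det_blockNormalForm_general`; the `det S`-term vanishes; the second polarisation is
`|κ|` pairs of read-outs through `adj S`, `(adj S)ᵀ`, `rank_dotProduct_mulVec_readOut_le`).
[cite: MignonRessayre2004, §2] -/
theorem rank_hess0_transl_le_of_blockNormalForm_general {q : ℕ} (l : R →ₗ[ℂ] ℂ)
    (A : Matrix (κ ⊕ Fin q) (κ ⊕ Fin q) (MvPolynomial σ R)) (F : MvPolynomial σ ℂ)
    (hA : ∀ a b, (A a b).totalDegree ≤ 1) (hF : ∀ d, l (coeff d A.det) = coeff d F)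
    (p : σ → ℂ) (S : Matrix (Fin q) (Fin q) R)
    (hB : A.map (eval fun i => algebraMap ℂ R (p i)) = Matrix.fromBlocks 1 0 0 S) (hS : S.det = 0)
    (Xf : σ → Matrix (κ ⊕ Fin q) (κ ⊕ Fin q) R)
    (hXf : ∀ s, (A.map fun a => eval (fun i => algebraMap ℂ R (p i)) (pderiv s a)) = Xf s) {g : ℕ}
    (hG : (Matrix.of fun s t : σ => l ((Xf s).toBlocks₁₁.trace * (S.adjugate * (Xf t).toBlocks₂₂).trace +
        (Xf t).toBlocks₁₁.trace * (S.adjugate * (Xf s).toBlocks₂₂).trace +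
        ∑ r, ∑ r', if r' = r then 0 else
          ((S.updateRow r ((Xf t).toBlocks₂₂ r)).updateRow r' ((Xf s).toBlocks₂₂ r')).det)).rank ≤ g) :
    (hess0 (transl p F)).rank ≤ g + Fintype.card κ *
      (Module.finrank ℂ (LinearMap.range (S.adjugate.mulVecLin.restrictScalars ℂ)) +
        Module.finrank ℂ (LinearMap.range (S.adjugateᵀ.mulVecLin.restrictScalars ℂ))) := by
  classical
  set x : σ → R := fun i => algebraMap ℂ R (p i) with hx
  -- the entries of the Hessian (the `det S`-term vanishes)
  have hE : ∀ s t, hess0 (transl p F) s t =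
      l ((S.adjugate * -((Xf s).toBlocks₂₁ * (Xf t).toBlocks₁₂ +
            (Xf t).toBlocks₂₁ * (Xf s).toBlocks₁₂)).trace +
          (∑ r, ∑ r', if r' = r then 0 else
            ((S.updateRow r ((Xf t).toBlocks₂₂ r)).updateRow r' ((Xf s).toBlocks₂₂ r')).det) +
          (Xf s).toBlocks₁₁.trace * (S.adjugate * (Xf t).toBlocks₂₂).trace +
          (Xf t).toBlocks₁₁.trace * (S.adjugate * (Xf s).toBlocks₂₂).trace) := by
    intro s t
    rw [hess0_transl_readOut l hF p s t,
      eval_pderiv_pderiv_det_blockNormalForm_general x s t A hA S hB (Xf s) (Xf t) (hXf s) (hXf t), hS,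
      mul_zero, add_zero]
  -- the pieces
  set G : Matrix σ σ ℂ := Matrix.of fun s t : σ =>
    l ((Xf s).toBlocks₁₁.trace * (S.adjugate * (Xf t).toBlocks₂₂).trace +
      (Xf t).toBlocks₁₁.trace * (S.adjugate * (Xf s).toBlocks₂₂).trace +
      ∑ r, ∑ r', if r' = r then 0 else
        ((S.updateRow r ((Xf t).toBlocks₂₂ r)).updateRow r' ((Xf s).toBlocks₂₂ r')).det) with hGdef
  set H₃ : κ → Matrix σ σ ℂ := fun c => Matrix.of fun s t =>
    l ((fun b => (Xf s).toBlocks₂₁ b c) ⬝ᵥ (S.adjugateᵀ *ᵥ fun a => (Xf t).toBlocks₁₂ c a)) with hH₃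
  set H₄ : κ → Matrix σ σ ℂ := fun c => Matrix.of fun s t =>
    l ((fun a => (Xf s).toBlocks₁₂ c a) ⬝ᵥ (S.adjugate *ᵥ fun b => (Xf t).toBlocks₂₁ b c)) with hH₄
  have hH : hess0 (transl p F) = G + -(∑ c, H₃ c) + -(∑ c, H₄ c) := by
    ext s t
    rw [hE s t, trace_adjugate_mul_neg_eq_sums, Matrix.add_apply, Matrix.add_apply, Matrix.neg_apply,
      Matrix.neg_apply, Matrix.sum_apply, Matrix.sum_apply]
    simp only [hGdef, hH₃, hH₄, Matrix.of_apply, map_add, map_neg, map_sum]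
    ring
  -- ranks of the pieces
  have h3 : ∀ c, (H₃ c).rank ≤
      Module.finrank ℂ (LinearMap.range (S.adjugateᵀ.mulVecLin.restrictScalars ℂ)) := fun c =>
    rank_dotProduct_mulVec_readOut_le l S.adjugateᵀ _ _
  have h4 : ∀ c, (H₄ c).rank ≤
      Module.finrank ℂ (LinearMap.range (S.adjugate.mulVecLin.restrictScalars ℂ)) := fun c =>
    rank_dotProduct_mulVec_readOut_le l S.adjugate _ _
  have h3s : (∑ c, H₃ c).rank ≤ Fintype.card κ *
      Module.finrank ℂ (LinearMap.range (S.adjugateᵀ.mulVecLin.restrictScalars ℂ)) := by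
    refine (rank_sum_le _ _).trans ?_
    calc ∑ c, (H₃ c).rank ≤ ∑ _c : κ,
        Module.finrank ℂ (LinearMap.range (S.adjugateᵀ.mulVecLin.restrictScalars ℂ)) :=
          Finset.sum_le_sum fun c _ => h3 c
      _ = _ := by rw [Finset.sum_const, Finset.card_univ, smul_eq_mul]
  have h4s : (∑ c, H₄ c).rank ≤ Fintype.card κ *
      Module.finrank ℂ (LinearMap.range (S.adjugate.mulVecLin.restrictScalars ℂ)) := by
    refine (rank_sum_le _ _).trans ?_
    calc ∑ c, (H₄ c).rank ≤ ∑ _c : κ,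
        Module.finrank ℂ (LinearMap.range (S.adjugate.mulVecLin.restrictScalars ℂ)) :=
          Finset.sum_le_sum fun c _ => h4 c
      _ = _ := by rw [Finset.sum_const, Finset.card_univ, smul_eq_mul]
  have hGr : G.rank ≤ g := hG
  rw [hH]
  refine (rank_add_le _ _).trans ?_
  refine (Nat.add_le_add (rank_add_le _ _) le_rfl).trans ?_
  rw [rank_neg_eq, rank_neg_eq]
  nlinarith [hGr, h3s, h4s]

/-- **With `AL(q)` as input:** if moreover `dim_ℂ Col(adj S) + dim_ℂ Row(adj S) ≤ 2·dim_ℂ R` then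
`rank Hess F(p) ≤ g + 2·|κ|·dim_ℂ R`. [cite: MignonRessayre2004, §2] -/
theorem rank_hess0_transl_le_of_blockNormalForm_general_of_AL {q : ℕ} (l : R →ₗ[ℂ] ℂ)
    (A : Matrix (κ ⊕ Fin q) (κ ⊕ Fin q) (MvPolynomial σ R)) (F : MvPolynomial σ ℂ)
    (hA : ∀ a b, (A a b).totalDegree ≤ 1) (hF : ∀ d, l (coeff d A.det) = coeff d F)
    (p : σ → ℂ) (S : Matrix (Fin q) (Fin q) R)
    (hB : A.map (eval fun i => algebraMap ℂ R (p i)) = Matrix.fromBlocks 1 0 0 S) (hS : S.det = 0)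
    (Xf : σ → Matrix (κ ⊕ Fin q) (κ ⊕ Fin q) R)
    (hXf : ∀ s, (A.map fun a => eval (fun i => algebraMap ℂ R (p i)) (pderiv s a)) = Xf s) {g : ℕ}
    (hG : (Matrix.of fun s t : σ => l ((Xf s).toBlocks₁₁.trace * (S.adjugate * (Xf t).toBlocks₂₂).trace +
        (Xf t).toBlocks₁₁.trace * (S.adjugate * (Xf s).toBlocks₂₂).trace +
        ∑ r, ∑ r', if r' = r then 0 else
          ((S.updateRow r ((Xf t).toBlocks₂₂ r)).updateRow r' ((Xf s).toBlocks₂₂ r')).det)).rank ≤ g)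
    (hAL : Module.finrank ℂ (LinearMap.range (S.adjugate.mulVecLin.restrictScalars ℂ)) +
        Module.finrank ℂ (LinearMap.range (S.adjugateᵀ.mulVecLin.restrictScalars ℂ)) ≤
      2 * Module.finrank ℂ R) :
    (hess0 (transl p F)).rank ≤ g + 2 * Fintype.card κ * Module.finrank ℂ R := by
  have h := rank_hess0_transl_le_of_blockNormalForm_general l A F hA hF p S hB hS Xf hXf hG
  have hk : Fintype.card κ *
      (Module.finrank ℂ (LinearMap.range (S.adjugate.mulVecLin.restrictScalars ℂ)) +
        Module.finrank ℂ (LinearMap.range (S.adjugateᵀ.mulVecLin.restrictScalars ℂ))) ≤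
      Fintype.card κ * (2 * Module.finrank ℂ R) := Nat.mul_le_mul_left _ hAL
  nlinarith [h, hk]

/-- **Diagonal residual blocks: `AL(q)` discharged.**  At `A(p) = diag(1_κ, diag(v))` with `∏ v_i = 0`:
`rank Hess F(p) ≤ g + 2·|κ|·dim_ℂ R`, `g` a bound for the symmetrised form `G`
(`finrank_range_adjugate_diagonal_le`). [cite: MignonRessayre2004, §2] -/
theorem rank_hess0_transl_le_of_blockNormalForm_diagonal {q : ℕ} (l : R →ₗ[ℂ] ℂ)
    (A : Matrix (κ ⊕ Fin q) (κ ⊕ Fin q) (MvPolynomial σ R)) (F : MvPolynomial σ ℂ)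
    (hA : ∀ a b, (A a b).totalDegree ≤ 1) (hF : ∀ d, l (coeff d A.det) = coeff d F)
    (p : σ → ℂ) (v : Fin q → R)
    (hB : A.map (eval fun i => algebraMap ℂ R (p i)) = Matrix.fromBlocks 1 0 0 (Matrix.diagonal v))
    (hv : (Matrix.diagonal v).det = 0) (Xf : σ → Matrix (κ ⊕ Fin q) (κ ⊕ Fin q) R)
    (hXf : ∀ s, (A.map fun a => eval (fun i => algebraMap ℂ R (p i)) (pderiv s a)) = Xf s) {g : ℕ}
    (hG : (Matrix.of fun s t : σ => l ((Xf s).toBlocks₁₁.trace *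
        ((Matrix.diagonal v).adjugate * (Xf t).toBlocks₂₂).trace +
        (Xf t).toBlocks₁₁.trace * ((Matrix.diagonal v).adjugate * (Xf s).toBlocks₂₂).trace +
        ∑ r, ∑ r', if r' = r then 0 else
          (((Matrix.diagonal v).updateRow r ((Xf t).toBlocks₂₂ r)).updateRow r'
            ((Xf s).toBlocks₂₂ r')).det)).rank ≤ g) :
    (hess0 (transl p F)).rank ≤ g + 2 * Fintype.card κ * Module.finrank ℂ R := by
  classical
  refine rank_hess0_transl_le_of_blockNormalForm_general_of_AL l A F hA hF p (Matrix.diagonal v) hB hv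
    Xf hXf hG ?_
  have hT : (Matrix.diagonal v).adjugateᵀ = (Matrix.diagonal v).adjugate := by
    rw [Matrix.adjugate_diagonal, Matrix.diagonal_transpose]
  rw [hT, ← two_mul]
  exact Nat.mul_le_mul_left 2 (finrank_range_adjugate_diagonal_le v hv)

end RankGeneral

end Summit.ValiantsHypothesis.ValiantsHypothesis.Theorems.GrenetZeonPolySizeQPAlgebra

end
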